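import Summits.CriticalPhenomena.PercolationContinuityZ3.Theorems.PercNearOneGluingNoHeavyLowerTailSahiPivotFamily
import Mathlib
import HarnessLib
import HarnessLib.Audit.Tags

/-!
# `NoHeavyLowerTail` (crux stmt-CriticalPhenomena-4575), master-family line P1 (gen 16):
# the ONE-PAYER DICHOTOMY for the tripartition sum — `T ≤ max(3·S_A, 3·S_B)` — a refinement of CP3⁺ at pure patterns

Support file (seat `prim-masterthm-p1`, gen 16; `--supports stmt-CriticalPhenomena-4575`), on top of the tree's
`SahiPivotFamily` (pivot accounting of the CP3⁺ tripartition sum) and `AntipodalStrongHarris`.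
Memo `run/shared/lean/prim/prim-masterthm/FROM-prim-masterthm-p1-g16-ONE-PAYER.md` §2.

VOCABULARY (tree).  A sunflower labeling `f : 2^S → {B < C₁,…,C_k < A}`; `antipodalSum E f f = Σ_{X ⊆ E} κ(f X, f(E∖X))`
(Gladkov's surplus of the cube `2^E`, `≥ 0` by `antipodalSum_self_nonneg`); the CP3⁺ tripartition sum
`pivotSum S S f = Σ_{(W,X,Y) ⊢ S} λ(f W; f X, f Y)` with `λ(a;b,c) = 3[a polar]κ(b,c) − [a,b,c rainbow]`.

NEW HERE (gen 16).
* `sideSum S f a := Σ_{W ⊆ S, f W = a} 3·antipodalSum (S∖W) f f` — the capacity offered by the pivots carrying label `a`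
  (`a = A`: CORE side `3S_A`; `a = B`: OUTSIDE side `3S_B`), and `rainbowSum S f` = the number `T` of ordered rainbow
  tripartitions; the **pivot accounting identity** `pivotSum S S f = sideSum A + sideSum B − rainbowSum`
  (`pivotSum_self_eq_sides`), so CP3⁺ at pure patterns reads `T ≤ 3S_A + 3S_B`; each side is `≥ 0` (`sideSum_nonneg`).
* **CONJECTURE (one-payer dichotomy, typed `PivotDichotomy k`)**: for every sunflower labeling, `T ≤ 3S_A` **or** `T ≤ 3S_B`
  — one of the two payers alone suffices.  Each disjunct alone is FALSE (`T ≤ 3S_B` is gen 14's H∅, false from 6 coordinates;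
  `T ≤ 3S_A` fails already on std3); the disjunction is census-clean: all 49 861 021 labelings of `2^5` (where in fact
  `T ≤ 3S_B` always), every fibre (all 2^m twisted patterns) of ≈ 50 000 random / union-generated / composite / perturbed systems
  on `2^6 … 2^9` (6.9·10⁶ fibres, among them the H∅ killers, where the core pays EXACTLY: `T = 3S_A`), 0 failures, and never
  `max(3S_A,3S_B) < T ≤ 3S_A+3S_B` ("needs both") — while systems whose different fibres need different payers do occur.
  THEOREM of the memo (§2, block calculus): for every 3-block composite `std3∘(c₁,c₂,c₃)` (arbitrary Boolean blocks) and every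
  fibre, `3S_B = T` identically; for `dual-std3∘(c₁,c₂,c₃)`, `3S_A = T` — covering every tight case and killer of record.
* kernel link `purePatternCP3Plus_of_pivotDichotomy`: the dichotomy implies CP3⁺ at pure patterns.
HONEST FRAMING: typed conjecture + identity + link; the dichotomy and CP3⁺ remain OPEN. [this work]
-/

namespace Summit.CriticalPhenomena.PercolationContinuityZ3.Theorems

namespace SahiPivotFamily

open Finset AntipodalStrongHarris AntipodalStrongHarris.Lab

variable {k : ℕ}

variable {α : Type*} [DecidableEq α]

/-! ### 1. The two sides and the rainbow count -/

/-- **Capacity of the pivots with label `a`**: `Σ_{W ⊆ S, f W = a} 3·Σ_{X ⊆ S∖W} κ(f X, f(S∖W∖X))` — for `a = A` the core side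
`3S_A`, for `a = B` the outside side `3S_B` of the pivot accounting. [this work] -/
def sideSum (S : Finset α) (f : Finset α → Lab k) (a : Lab k) : ℤ :=
  ∑ W ∈ S.powerset with f W = a, 3 * antipodalSum (S \ W) f f

/-- **The ordered rainbow count** `T = #{(W,X,Y) ⊢ S : f W, f X, f Y three pairwise different petals}`. [this work] -/
def rainbowSum (S : Finset α) (f : Finset α → Lab k) : ℤ :=
  ∑ W ∈ S.powerset, ∑ X ∈ (S \ W).powerset, rainbow (f W) (f X) (f ((S \ W) \ X))

/-- Each side is nonnegative for a sunflower labeling (a sum of Gladkov surpluses, tree `antipodalSum_self_nonneg`). [this work] -/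
theorem sideSum_nonneg (S : Finset α) (f : Finset α → Lab k) (hf : ∀ ⦃X Y : Finset α⦄, X ⊆ Y → f X ≤ f Y)
    (a : Lab k) : 0 ≤ sideSum S f a :=
  sum_nonneg fun W _ => mul_nonneg (by norm_num) (antipodalSum_self_nonneg (S \ W) f hf)

/-- The rainbow count is nonnegative. [this work] -/
theorem rainbowSum_nonneg (S : Finset α) (f : Finset α → Lab k) : 0 ≤ rainbowSum S f :=
  sum_nonneg fun _ _ => sum_nonneg fun _ _ => rainbow_nonneg _ _ _

/-- The inner sum at a fixed pivot: `Σ_X λ(f W; f X, f Y) = 3[f W polar]·antipodalSum − Σ_X rainbow`. [this work] -/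
theorem inner_pivot_eq (S W : Finset α) (f : Finset α → Lab k) :
    ∑ X ∈ (S \ W).powerset, lam (f W) (f X) (f ((S \ W) \ X)) =
      3 * polar (f W) * antipodalSum (S \ W) f f
        - ∑ X ∈ (S \ W).powerset, rainbow (f W) (f X) (f ((S \ W) \ X)) := by
  simp only [lam, antipodalSum, mul_sum, sum_sub_distrib]

/-- `3·[a polar]·C` splits as the `A`-indicator part plus the `B`-indicator part. [this work] -/
private theorem polar_split (a : Lab k) (C : ℤ) :
    3 * polar a * C = (if a = top then 3 * C else 0) + (if a = bot then 3 * C else 0) := by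
  rcases a with _ | i | _ <;> simp [polar]

/-- **Pivot accounting identity**: `pivotSum S S f = 3S_A + 3S_B − T`. [this work] -/
theorem pivotSum_self_eq_sides (S : Finset α) (f : Finset α → Lab k) :
    pivotSum S S f = sideSum S f top + sideSum S f bot - rainbowSum S f := by
  unfold pivotSum rainbowSum sideSum
  rw [sum_filter, sum_filter, ← sum_add_distrib, ← sum_sub_distrib]
  refine sum_congr rfl fun W _ => ?_
  rw [inner_pivot_eq, polar_split]

/-- **CP3⁺ at pure patterns in one-payer form**: `0 ≤ pivotSum S S f ↔ T ≤ 3S_A + 3S_B`. [this work] -/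
theorem pivotSum_self_nonneg_iff (S : Finset α) (f : Finset α → Lab k) :
    0 ≤ pivotSum S S f ↔ rainbowSum S f ≤ sideSum S f top + sideSum S f bot := by
  rw [pivotSum_self_eq_sides]; constructor <;> intro h <;> linarith

/-! ### 2. The typed dichotomy and the kernel link -/

/-- **CONJECTURE (one-payer dichotomy; typed).**  For every `k`, every finite `S ⊆ ℕ` and every sunflower labeling `f` of its
subsets: `T ≤ 3S_A` or `T ≤ 3S_B` — the ordered rainbow tripartitions are paid for by the core pivots ALONE or by the outside
pivots ALONE.  Refines CP3⁺ at pure patterns (`T ≤ 3S_A + 3S_B`, `purePatternCP3Plus_of_pivotDichotomy`); each disjunct alone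
is false; exact census in the file header, 0 failures; proved for all 3-block composites of std3 / dual-std3 (memo §2).
[this work] [status: open] -/
@[conjecture] def PivotDichotomy (k : ℕ) : Prop :=
  ∀ (S : Finset ℕ) (f : Finset ℕ → Lab k), (∀ ⦃X Y : Finset ℕ⦄, X ⊆ Y → f X ≤ f Y) →
    rainbowSum S f ≤ sideSum S f top ∨ rainbowSum S f ≤ sideSum S f bot

/-- **Kernel link: the one-payer dichotomy implies CP3⁺ at pure patterns** (the other side is nonnegative). [this work] -/
theorem purePatternCP3Plus_of_pivotDichotomy (hk : PivotDichotomy k) : PurePatternCP3Plus k := by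
  intro S f hf
  rw [pivotSum_self_nonneg_iff]
  have hA := sideSum_nonneg S f hf top
  have hB := sideSum_nonneg S f hf bot
  rcases hk S f hf with h | h <;> linarith

end SahiPivotFamily

end Summit.CriticalPhenomena.PercolationContinuityZ3.Theorems
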